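import Summits.NavierStokesRegularity.NavierStokesRegularity.Theorems.NoOverheating.Negative.FineRatioWindowsExcluded
import Summits.NavierStokesRegularity.NavierStokesRegularity.Theorems.NoOverheating.Negative.AxisymmetricWindowsExcluded
import Summits.NavierStokesRegularity.NavierStokesRegularity.Theorems.DssFarFieldSlavingBlowupTypeIDssProfileFiniteOrderTwist

/-!
# KJ-34 — the FINITE-ORDER (torsion) stratum of the rotations is EXCLUDED below Chae–Wolf's threshold
# from the window sequences of route `AngularGalerkinLadder` (Bradshaw–Tsai 2017 §1 + Chae–Wolf 2017 Thm 1.3)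

Refuter bookkeeping turned theorem (ns-blowup refuter lineage, plain Negative lane, `--supports`
item stmt-NavierStokesRegularity-19960 `NoOverheating`; no definition, no positive route statement).
Continuation of KJ-33 (`FineRatioWindowsExcluded.lean`): there the UNROTATED stratum (`Rₙ x → x`)
of K2's windows was shown empty below `λ₁(C₀)`; here the same printed criterion reaches every
stratum of rotations of FINITE ORDER `q` — half-turns and reflections and the central inversion
(`q = 2`), quarter-turns (`q = 4`), any `Rₙ` with `Rₙ^q = 1`, and sequences whose `q`-th powers
merely tend to the identity — at the price of the window top entering through its `q`-th power:

* (imported, tree: `isRotatedDSS_pow`, `isDiscretelySelfSimilar_pow_of_isRotatedDSS` of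
  `Theorems/DssFarFieldSlavingBlowupTypeIDssProfileFiniteOrderTwist.lean`) — a `(c, R)`-rotated-DSS
  field is `(c^q, R^q)`-rotated-DSS, hence PLAINLY `c^q`-DSS when `R^q = 1` (Bradshaw–Tsai 2017 §1:
  a phase in `2πℚ` is no phase at a longer period);
* `tendsto_pow_apply`, `pow_eq_one_of_tendsto` — finite order passes to pointwise limits of
  isometries;
* `no_windowSequence_torsion_fineRatio` — for every `C₀` and Chae–Wolf's `c₁ = λ₁(C₀) > 1` (the
  SAME threshold for all `q`): NO admissible window sequence with constant `C₀`, rotations whose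
  `q`-th powers tend pointwise to the identity (`0 < q`) and window top `cmax ^ q < c₁` exists —
  the ladder limit (`exists_ladderLimit_typeI`) is `(c', R')`-rotated-DSS with `R' ^ q = 1` and
  `1 < c' ≤ cmax`, so plainly `c'^q`-DSS with `1 < c'^q < c₁`, classical for one pressure on the
  past, Type-I with constant `C₀`: zero by `chaeWolf2017_removing_dss_holds`, against
  non-triviality (`C₀ ≤ 0` is vacuous by the amplitude floor);
* `no_windowSequence_finiteOrder_fineRatio` (`Rₙ ^ q = 1`), `no_involutive_windowSequence_fineRatio`
  (`Rₙ (Rₙ x) = x`: half-turns about any axes, reflections, `−1`; `cmax² < c₁`);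
* `not_cofinal_and_noOverheating_finiteOrder`, `rungBlowupCofinal_false_of_noOverheating_finiteOrder`
  — read on the open cruxes: K1 `RungBlowupCofinal` (19959) ∧ K2 (19960) with window profiles
  whose DSS-rotations have order dividing `q` and `cmax ^ q < λ₁(C₀)` is FALSE; a K2 met on the
  torsion-`q` stratum must let its window reach above `λ₁(C₀)^{1/q}`.

For `q = 1` this is KJ-33's `no_windowSequence_fineRatio` again. What ESCAPES (recorded, not
typed): rotations of infinite order / irrational angle in the limit (Pineau–Vicol 2026 Thm 1.7
covers angular speeds `|α| ≤ α₁` or `≥ α₂` only; the tree's CorkscrewDynamo files show the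
near-identity factor regime `c → 1` is rigid, but K2's windows have `cmin > 1` fixed), and coarse
windows `cmax ^ q ≥ λ₁(C₀)` (Bradshaw–Tsai OP 5.1 = `TypeIDSSLiouvilleConjecture`, KJ-17/31).

LABEL: KERNEL. WHAT THIS IS NOT: not NS — no rung solution, window or profile is constructed; no
item changes verdict; `λ₁(C₀)` is the tree's bare existential.
References: [cite: BradshawTsai2017CPDE, §1 (rotated discretely self-similar fields, arXiv:1610.05680 p. 4)];
[cite: ChaeWolf2017RemovingDSS, Theorem 1.3 (arXiv:1610.09464 p. 3)];
[cite: PineauVicol2026, Theorem 1.7 (arXiv:2607.09619 p. 7)].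
-/

namespace Summit.NavierStokesRegularity.AngularGalerkinLadderTorsionWindowsExcluded

open Set Filter MeasureTheory Topology Function
open Literature.Analysis Literature.Analysis.FluidPDE
open Literature.Barriers.NavierStokesRegularity
open Summit.NavierStokesRegularity.FluidComputer
open Summit.NavierStokesRegularity.NavierStokesRegularity.Theses.AngularGalerkinLadder
open Summit.NavierStokesRegularity.AngularGalerkinLadderLadderLimit
open Summit.NavierStokesRegularity.AngularGalerkinLadderFineRatioWindowsExcluded
open Summit.NavierStokesRegularity.AngularGalerkinLadderAxisymmetricWindowsExcluded
open Summit.NavierStokesRegularity.NavierStokesRegularity.Theorems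
  (isDiscretelySelfSimilar_pow_of_isRotatedDSS)

/-! ### §1 Finite order passes to pointwise limits of isometries -/

/-- Pointwise convergence of isometries gives pointwise convergence of their `q`-th powers.
[folklore] -/
theorem tendsto_pow_apply
    {R : ℕ → (EuclideanSpace ℝ (Fin 3) ≃ₗᵢ[ℝ] EuclideanSpace ℝ (Fin 3))}
    {R' : EuclideanSpace ℝ (Fin 3) ≃ₗᵢ[ℝ] EuclideanSpace ℝ (Fin 3)}
    (hR : ∀ x, Tendsto (fun n => R n x) atTop (𝓝 (R' x))) :
    ∀ (q : ℕ) (x : EuclideanSpace ℝ (Fin 3)),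
      Tendsto (fun n => ((R n) ^ q) x) atTop (𝓝 ((R' ^ q) x))
  | 0, x => by simp
  | q + 1, x => by
      have ih := tendsto_pow_apply hR q x
      have h := tendsto_linearIsometryEquiv_apply_of_tendsto hR ih
      simp only [pow_succ', LinearIsometryEquiv.coe_mul, Function.comp_apply]
      exact h

/-- If the `q`-th powers of the isometries `Rₙ → R'` (pointwise) tend pointwise to the identity,
the limit has order dividing `q`: `R' ^ q = 1`. [folklore] -/
theorem pow_eq_one_of_tendsto
    {R : ℕ → (EuclideanSpace ℝ (Fin 3) ≃ₗᵢ[ℝ] EuclideanSpace ℝ (Fin 3))}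
    {R' : EuclideanSpace ℝ (Fin 3) ≃ₗᵢ[ℝ] EuclideanSpace ℝ (Fin 3)}
    (hR : ∀ x, Tendsto (fun n => R n x) atTop (𝓝 (R' x))) {q : ℕ}
    (hq : ∀ x, Tendsto (fun n => ((R n) ^ q) x) atTop (𝓝 x)) : R' ^ q = 1 :=
  LinearIsometryEquiv.ext fun x => by
    rw [LinearIsometryEquiv.coe_one, id]
    exact tendsto_nhds_unique (tendsto_pow_apply hR q x) (hq x)

/-! ### §2 The torsion stratum below Chae–Wolf's threshold is empty -/

/-- **No admissible window sequence on the torsion-`q` stratum below `λ₁(C₀)^{1/q}`.** For every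
`C₀` there is Chae–Wolf's `c₁ = λ₁(C₀) > 1` — ONE threshold for all orders — such that: constants
`1 < cmin`, `0 < δ`, defect sizes `εₙ → 0`, a window rung profile with constant `C₀` and window
`[cmin, cmax]` at every index, rotations `Rₙ` whose `q`-th powers tend pointwise to the identity
(`0 < q`), and `cmax ^ q < c₁`, are contradictory. (Ladder limit `(c', R')`-RDSS with `R' ^ q = 1`,
hence plainly `c'^q`-DSS with `1 < c'^q ≤ cmax^q < c₁`, classical with one pressure on the past,
Type-I `C₀`: Chae–Wolf 2017 Thm 1.3 removes it.) [cite: ChaeWolf2017RemovingDSS, Theorem 1.3 (arXiv:1610.09464 p. 3)] -/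
theorem no_windowSequence_torsion_fineRatio (C₀ : ℝ) :
    ∃ c₁ : ℝ, 1 < c₁ ∧ ∀ {q : ℕ} {cmin cmax δ : ℝ} {L : ℕ → ℕ} {ε c : ℕ → ℝ}
      {R : ℕ → (EuclideanSpace ℝ (Fin 3) ≃ₗᵢ[ℝ] EuclideanSpace ℝ (Fin 3))}
      {u : ℕ → ℝ → EuclideanSpace ℝ (Fin 3) → EuclideanSpace ℝ (Fin 3)}
      {p : ℕ → ℝ → EuclideanSpace ℝ (Fin 3) → ℝ}
      {d : ℕ → ℝ → EuclideanSpace ℝ (Fin 3) → EuclideanSpace ℝ (Fin 3)},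
      0 < q → cmax ^ q < c₁ → 1 < cmin → 0 < δ → Tendsto ε atTop (𝓝 0) →
      (∀ n, AngularLadder.IsWindowProfile (L n) C₀ cmin cmax δ (ε n) (c n) (R n) (u n) (p n)
        (d n)) →
      (∀ x, Tendsto (fun n => ((R n) ^ q) x) atTop (𝓝 x)) → False := by
  by_cases hC₀ : 0 < C₀
  · obtain ⟨c₁, hc₁, H⟩ := chaeWolf2017_removing_dss_holds C₀ hC₀
    refine ⟨c₁, hc₁, fun {q cmin cmax δ L ε c R u p d} hq hcmax hcmin hδ hε hW hRq => ?_⟩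
    obtain ⟨φ, c', R', v, hφ, hc'mem, -, hRlim, -, -, -, hc', hTAM, -, hDSS, hTI, -, hnz⟩ :=
      exists_ladderLimit_typeI hcmin hδ hε hW
    obtain ⟨P, hP⟩ := exists_classical_Iio hTAM
    -- the limit rotation has order dividing `q`
    have hR'q : R' ^ q = 1 :=
      pow_eq_one_of_tendsto hRlim fun x => (hRq x).comp hφ.tendsto_atTop
    have hdss : IsDiscretelySelfSimilar (c' ^ q) v :=
      isDiscretelySelfSimilar_pow_of_isRotatedDSS hDSS hR'q
    have hq0 : q ≠ 0 := Nat.pos_iff_ne_zero.1 hq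
    have h1 : 1 < c' ^ q := one_lt_pow₀ hc' hq0
    have h2 : c' ^ q < c₁ :=
      lt_of_le_of_lt (pow_le_pow_left₀ (zero_le_one.trans hc'.le) hc'mem.2 q) hcmax
    have hz : ∀ t < 0, ∀ x, v t x = 0 := H (c' ^ q) h1 h2 v P hP hdss hTI
    exact hnz fun t ht => Eventually.of_forall (hz t ht)
  · refine ⟨2, one_lt_two, fun {q cmin cmax δ L ε c R u p d} _ _ _ hδ _ hW _ => ?_⟩
    exact hC₀ (typeI_const_pos_of_window hδ (hW 0))

/-- **Rotations of order dividing `q`** (`Rₙ ^ q = 1` at every index): no admissible window sequence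
with constant `C₀` and `cmax ^ q < λ₁(C₀)`. [cite: ChaeWolf2017RemovingDSS, Theorem 1.3 (arXiv:1610.09464 p. 3)] -/
theorem no_windowSequence_finiteOrder_fineRatio (C₀ : ℝ) :
    ∃ c₁ : ℝ, 1 < c₁ ∧ ∀ {q : ℕ} {cmin cmax δ : ℝ} {L : ℕ → ℕ} {ε c : ℕ → ℝ}
      {R : ℕ → (EuclideanSpace ℝ (Fin 3) ≃ₗᵢ[ℝ] EuclideanSpace ℝ (Fin 3))}
      {u : ℕ → ℝ → EuclideanSpace ℝ (Fin 3) → EuclideanSpace ℝ (Fin 3)}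
      {p : ℕ → ℝ → EuclideanSpace ℝ (Fin 3) → ℝ}
      {d : ℕ → ℝ → EuclideanSpace ℝ (Fin 3) → EuclideanSpace ℝ (Fin 3)},
      0 < q → cmax ^ q < c₁ → 1 < cmin → 0 < δ → Tendsto ε atTop (𝓝 0) →
      (∀ n, AngularLadder.IsWindowProfile (L n) C₀ cmin cmax δ (ε n) (c n) (R n) (u n) (p n)
        (d n)) →
      (∀ n, (R n) ^ q = 1) → False := by
  obtain ⟨c₁, hc₁, H⟩ := no_windowSequence_torsion_fineRatio C₀
  refine ⟨c₁, hc₁, fun {q cmin cmax δ L ε c R u p d} hq hcmax hcmin hδ hε hW hRq => ?_⟩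
  refine H hq hcmax hcmin hδ hε hW fun x => ?_
  have : (fun n => ((R n) ^ q) x) = fun _ => x := funext fun n => by
    rw [hRq n, LinearIsometryEquiv.coe_one, id]
  rw [this]
  exact tendsto_const_nhds

/-- **Involutive rotations** (`Rₙ (Rₙ x) = x`: half-turns about arbitrary — varying — axes,
reflections, the central inversion `−1`): no admissible window sequence with constant `C₀` and
`cmax ^ 2 < λ₁(C₀)`. [cite: ChaeWolf2017RemovingDSS, Theorem 1.3 (arXiv:1610.09464 p. 3)] -/
theorem no_involutive_windowSequence_fineRatio (C₀ : ℝ) :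
    ∃ c₁ : ℝ, 1 < c₁ ∧ ∀ {cmin cmax δ : ℝ} {L : ℕ → ℕ} {ε c : ℕ → ℝ}
      {R : ℕ → (EuclideanSpace ℝ (Fin 3) ≃ₗᵢ[ℝ] EuclideanSpace ℝ (Fin 3))}
      {u : ℕ → ℝ → EuclideanSpace ℝ (Fin 3) → EuclideanSpace ℝ (Fin 3)}
      {p : ℕ → ℝ → EuclideanSpace ℝ (Fin 3) → ℝ}
      {d : ℕ → ℝ → EuclideanSpace ℝ (Fin 3) → EuclideanSpace ℝ (Fin 3)},
      cmax ^ 2 < c₁ → 1 < cmin → 0 < δ → Tendsto ε atTop (𝓝 0) →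
      (∀ n, AngularLadder.IsWindowProfile (L n) C₀ cmin cmax δ (ε n) (c n) (R n) (u n) (p n)
        (d n)) →
      (∀ n x, R n (R n x) = x) → False := by
  obtain ⟨c₁, hc₁, H⟩ := no_windowSequence_finiteOrder_fineRatio C₀
  refine ⟨c₁, hc₁, fun {cmin cmax δ L ε c R u p d} hcmax hcmin hδ hε hW hinv => ?_⟩
  exact H two_pos hcmax hcmin hδ hε hW fun n => LinearIsometryEquiv.ext fun x => by
    rw [pow_two, LinearIsometryEquiv.coe_mul, Function.comp_apply, hinv n x,
      LinearIsometryEquiv.coe_one, id]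

/-! ### §3 Read on the open cruxes -/

/-- **K1 ∧ (K2 on the torsion-`q` stratum below `λ₁(C₀)^{1/q}`) is FALSE.** For every `C₀` there
is `c₁ = λ₁(C₀) > 1` such that for every order `q ≥ 1`: `RungBlowupCofinal` together with a
`NoOverheating` with constant `C₀`, window top `cmax ^ q < c₁` and window profiles whose
DSS-rotation `R` satisfies `R ^ q = 1` (plain DSS `q = 1`; half-turn / reflection-twisted `q = 2`;
quarter-turn `q = 4`; …) is contradictory. [cite: ChaeWolf2017RemovingDSS, Theorem 1.3 (arXiv:1610.09464 p. 3)] -/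
theorem not_cofinal_and_noOverheating_finiteOrder (C₀ : ℝ) :
    ∃ c₁ : ℝ, 1 < c₁ ∧ ∀ q : ℕ, 0 < q → ¬ (RungBlowupCofinal ∧
      ∃ (cmin cmax δ : ℝ) (L₀ : ℕ) (ε : ℕ → ℝ), cmax ^ q < c₁ ∧ 1 < cmin ∧ 0 < δ ∧
        Tendsto ε atTop (𝓝 0) ∧
        ∀ L ≥ L₀, AngularLadder.RungIsSingular L →
          ∃ (c : ℝ) (R : EuclideanSpace ℝ (Fin 3) ≃ₗᵢ[ℝ] EuclideanSpace ℝ (Fin 3))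
            (u : ℝ → EuclideanSpace ℝ (Fin 3) → EuclideanSpace ℝ (Fin 3))
            (p : ℝ → EuclideanSpace ℝ (Fin 3) → ℝ)
            (d : ℝ → EuclideanSpace ℝ (Fin 3) → EuclideanSpace ℝ (Fin 3)),
            AngularLadder.IsWindowProfile L C₀ cmin cmax δ (ε L) c R u p d ∧ R ^ q = 1) := by
  obtain ⟨c₁, hc₁, H⟩ := no_windowSequence_finiteOrder_fineRatio C₀
  refine ⟨c₁, hc₁, fun q hq => ?_⟩
  rintro ⟨h₁, cmin, cmax, δ, L₀, ε, hcmax, hcmin, hδ, hε, hwin⟩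
  choose L hLge hLsing using fun n : ℕ => h₁ (max L₀ n)
  choose c R u p d hW hRq using fun n : ℕ =>
    hwin (L n) (le_trans (le_max_left _ _) (hLge n)) (hLsing n)
  have hε' : Tendsto (fun n : ℕ => ε (L n)) atTop (𝓝 0) :=
    hε.comp (tendsto_atTop_mono (fun n => le_trans (le_max_right _ _) (hLge n)) tendsto_id)
  exact H hq hcmax hcmin hδ hε' hW hRq

/-- Negative edge on K1 for the census: a `NoOverheating` met on the torsion-`q` stratum with
`cmax ^ q < λ₁(C₀)` refutes `RungBlowupCofinal`. [cite: ChaeWolf2017RemovingDSS, Theorem 1.3] -/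
theorem rungBlowupCofinal_false_of_noOverheating_finiteOrder (C₀ : ℝ) :
    ∃ c₁ : ℝ, 1 < c₁ ∧ ∀ {q : ℕ} {cmin cmax δ : ℝ} {L₀ : ℕ} {ε : ℕ → ℝ}, 0 < q → cmax ^ q < c₁ →
      1 < cmin → 0 < δ → Tendsto ε atTop (𝓝 0) →
      (∀ L ≥ L₀, AngularLadder.RungIsSingular L →
        ∃ (c : ℝ) (R : EuclideanSpace ℝ (Fin 3) ≃ₗᵢ[ℝ] EuclideanSpace ℝ (Fin 3))
          (u : ℝ → EuclideanSpace ℝ (Fin 3) → EuclideanSpace ℝ (Fin 3))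
          (p : ℝ → EuclideanSpace ℝ (Fin 3) → ℝ)
          (d : ℝ → EuclideanSpace ℝ (Fin 3) → EuclideanSpace ℝ (Fin 3)),
          AngularLadder.IsWindowProfile L C₀ cmin cmax δ (ε L) c R u p d ∧ R ^ q = 1) →
      ¬ RungBlowupCofinal := by
  obtain ⟨c₁, hc₁, H⟩ := not_cofinal_and_noOverheating_finiteOrder C₀
  exact ⟨c₁, hc₁, fun {q cmin cmax δ L₀ ε} hq hcmax hcmin hδ hε hwin h₁ =>
    H q hq ⟨h₁, cmin, cmax, δ, L₀, ε, hcmax, hcmin, hδ, hε, hwin⟩⟩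

end Summit.NavierStokesRegularity.AngularGalerkinLadderTorsionWindowsExcluded
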